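import Summits.AtomisticToContinuum.FouriersLaw.Theorems.BondHeatUncertaintyLightConeBondHeatBondCorrelation

/-!
# Stub `stub_autocorrelationContinuous` of line `drude-controls-conductance` (R1) — crux `JunctionLocality.NonBallistic`
(stmt-AtomisticToContinuum-9127)

STATUS (worker, 2026-08-16): complete — the registered stub `stub_autocorrelationContinuous`
(= `DrudeLine.AutocorrelationContinuous`, planners' stub 1 of both twin lines) is proved below, sorry-free, from tree
facts only (no neighbour stub is used).

For the pinned anharmonic chain `pinnedChain ω₂ lam β γ` (all parameters `> 0`) and `T > 0`, the equilibrium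
total-current autocorrelation `C_N(s) = ∫ J_tot · (κ_{s⁺} J_tot) dπ_T`, `J_tot = Σ_i j_i`, `κ_s` the constructed
equal-temperature transition kernels `transitionKernel N T T s⁺`, `π_T = gibbsMeasure N T`, is continuous in `s` for
every `N`.

Proof. The tree already has the generic statement `LightConeBondHeat.pinnedChain_continuous_autocorr`: for `N ≥ 1` and
ANY continuous observable `f` of exponential class `|f| ≤ C e^{ϑH}` with `0 < ϑ`, `2ϑ < 1/T`, the autocorrelation
`u ↦ ∫ f · κ_{u⁺} f dπ_T` is continuous (uniform limit of the autocorrelations of the bounded truncations of `f` via the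
`L²(π_T)`-contraction). The total current is such an observable: each bond current satisfies
`|j_i| ≤ M_N(ϑ) e^{ϑH}` for every `ϑ > 0` (`pinnedChain_abs_bondCurrent_le_exp`), so `|J_tot| ≤ N M_N(ϑ) e^{ϑH}`, and
`ϑ = 1/(4T)` is admissible (`quarter_inv_temp_admissible`). For `N = 0` the sum over `Fin 0` is empty, `J_tot ≡ 0`
and `C_0 ≡ 0` is constant.
-/

noncomputable section

open MeasureTheory Set Filter Topology
open scoped NNReal ENNReal BigOperators
open Literature.MathematicalPhysics.KineticTheory.HeatConduction

namespace Summit.AtomisticToContinuum.FouriersLaw.Theorems.NonBallistic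

open ProbabilityTheory
open Literature.MathematicalPhysics.KineticTheory Literature.Probability.Process OscillatorChain
open Summit.AtomisticToContinuum.FouriersLaw.Theorems.SubdiffusiveBondHeat
open Summit.AtomisticToContinuum.FouriersLaw.Theorems.LightConeBondHeat

/-- The total current `J_tot = Σ_i j_i` of the pinned chain is a continuous observable. [folklore] -/
theorem pinnedChain_continuous_totalBondCurrent (ω₂ lam β γ : ℝ) (N : ℕ) :
    Continuous fun x : PhaseSpace N => ∑ i : Fin N, (pinnedChain ω₂ lam β γ).bondCurrent N i x :=
  continuous_finsetSum _ fun i _ => pinnedChain_continuous_bondCurrent ω₂ lam β γ N i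

/-- The total current `J_tot = Σ_i j_i` of the pinned chain is of exponential class for every `ϑ > 0`:
`|J_tot| ≤ N · M_N(ϑ) e^{ϑH}` with `M_N(ϑ) = N (3+β)/2 · 2e^{ϑ}/ϑ²` (sum of `pinnedChain_abs_bondCurrent_le_exp`).
[folklore] -/
theorem pinnedChain_abs_totalBondCurrent_le_exp {ω₂ lam β : ℝ} (hω : 0 ≤ ω₂) (hl : 0 ≤ lam) (hβ : 0 ≤ β) (γ : ℝ)
    (N : ℕ) {ϑ : ℝ} (hϑ : 0 < ϑ) (y : PhaseSpace N) :
    |∑ i : Fin N, (pinnedChain ω₂ lam β γ).bondCurrent N i y| ≤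
      (N * (N * ((3 + β) / 2) * (2 * Real.exp ϑ / ϑ ^ 2))) *
        Real.exp (ϑ * (pinnedChain ω₂ lam β γ).hamiltonian N y) := by
  calc |∑ i : Fin N, (pinnedChain ω₂ lam β γ).bondCurrent N i y|
      ≤ ∑ i : Fin N, |(pinnedChain ω₂ lam β γ).bondCurrent N i y| := Finset.abs_sum_le_sum_abs _ _
    _ ≤ ∑ _i : Fin N, (N * ((3 + β) / 2) * (2 * Real.exp ϑ / ϑ ^ 2)) *
          Real.exp (ϑ * (pinnedChain ω₂ lam β γ).hamiltonian N y) :=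
        Finset.sum_le_sum fun i _ => pinnedChain_abs_bondCurrent_le_exp hω hl hβ γ N hϑ i y
    _ = (N * (N * ((3 + β) / 2) * (2 * Real.exp ϑ / ϑ ^ 2))) *
          Real.exp (ϑ * (pinnedChain ω₂ lam β γ).hamiltonian N y) := by
        rw [Finset.sum_const, Finset.card_univ, Fintype.card_fin, nsmul_eq_mul]
        ring

/-- **Stub `stub_autocorrelationContinuous`** (= `DrudeLine.AutocorrelationContinuous`, VERBATIM the planners' stub 1
of both twin lines `drude-controls-conductance` and `transit-entropy-pairing`): for the pinned chain (all parameters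
`> 0`), `T > 0` and the equilibrium total-current autocorrelation `C` pinned by its defining equation,
`s ↦ C_N(s)` is continuous for every `N` (generic autocorrelation continuity
`LightConeBondHeat.pinnedChain_continuous_autocorr` applied to the total current, an observable of exponential class;
`N = 0`: `C_0 ≡ 0`). [folklore] -/
theorem stub_autocorrelationContinuous :
    ∀ ω₂ lam β γ : ℝ, 0 < ω₂ → 0 < lam → 0 < β → 0 < γ → ∀ T : ℝ, 0 < T →
    ∀ C : ℕ → ℝ → ℝ,
      C = (fun (N : ℕ) (s : ℝ) => ∫ x, (∑ i : Fin N, (pinnedChain ω₂ lam β γ).bondCurrent N i x) *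
            (∫ y, (∑ i : Fin N, (pinnedChain ω₂ lam β γ).bondCurrent N i y)
              ∂((pinnedChain ω₂ lam β γ).transitionKernel N T T s.toNNReal x))
            ∂((pinnedChain ω₂ lam β γ).gibbsMeasure N T)) →
      ∀ N : ℕ, Continuous (C N) := by
  intro ω₂ lam β γ hω hl hβ hγ T hT C hC N
  subst hC
  rcases Nat.eq_zero_or_pos N with rfl | hN
  · -- no bond: the total current over `Fin 0` is the empty sum, `C_0 ≡ 0`
    simp only [Finset.univ_eq_empty, Finset.sum_empty, zero_mul, integral_zero]
    exact continuous_const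
  · exact pinnedChain_continuous_autocorr hω hl.le hβ hγ hN hT (quarter_inv_temp_admissible hT).1
      (quarter_inv_temp_admissible hT).2 (pinnedChain_continuous_totalBondCurrent ω₂ lam β γ N)
      (pinnedChain_abs_totalBondCurrent_le_exp hω.le hl.le hβ.le γ N (quarter_inv_temp_admissible hT).1)

end Summit.AtomisticToContinuum.FouriersLaw.Theorems.NonBallistic

end
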